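import Literature.RingTheory.MvPolynomial.NoetherFormsGenericRoot
import Mathlib.RingTheory.Polynomial.Resultant.Basic
import Mathlib.RingTheory.Polynomial.GaussLemma
import Mathlib.RingTheory.Polynomial.RationalRoot
import Mathlib.LinearAlgebra.Matrix.ToLinearEquiv
import Mathlib.LinearAlgebra.Matrix.Rank
import HarnessLib

/-!
# Effective Noether forms, Stage I (continued): the generic linear system, its minors, and the
# irreducibility criterion at a simple root

Support file for the proof of Kaltofen's Theorem 7 (`kaltofen1995_thm7`; E. Kaltofen, *Effective
Noether irreducibility forms and applications*, J. Comput. System Sci. 50 (1995) 274–295, §2 Step L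
and §5). Kaltofen's Step L asks whether some non-zero `Σ hᵢ(y) αⁱ` of `x`-degree `< d` vanishes to
order `y^{ℓ+1}` on the truncated root `α`; irreducibility of `f` is equivalent to the unsolvability
of this linear system (§2, correctness of "Absolute Irreducibility Test", resting on the resultant
argument of [Kaltofen 1985a, Thm. 1]), and the maximal minors of its generic version are the
ingredients of the Noether forms (§5, proof of Thm. 7).

Here (continuing the SCALED, single-root organisation of `NoetherFormsGenericRoot`):

* the generic matrix `Mgen d a k (i,j) = [y^k] reduce((z + δ̂Ā)ⁱ (δ̂²y)ʲ)`, `k ≤ ℓ d = (2d-1)d`,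
  columns indexed by `Idx d` (`i < d`, `j ≤ d`); its maximal minors `minor d a S`
  (`S : Idx d → Fin (ℓ d + 1)`, arbitrary — non-injective `S` give `0`), their reductions modulo
  `genF0` and the coefficients `tauR d a (S, ι)`, `ι < d` — for `R = E₂ d`, `a = X` these are the
  integer polynomials entering the Noether forms; everything commutes with ring maps (`map_tauR`);
* SPECIALISATION at a simple root: over a field `k` with coefficient vector `b`, a root `ζ₀` of
  `genF0 d b` with `δ₀ = genF0'(ζ₀) ≠ 0`, the truncated scaled root
  `β̃ = ζ₀ + δ₀ Ā(ℓ)(ζ₀)` satisfies `y^{ℓ+1} ∣ ψ(β̃(y), δ₀² y)` (`X_pow_dvd_evθ_ψ`) for the monic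
  bivariate `ψ = x^d + Σ b_{ij} xⁱ yʲ ∈ k[y][x]` (`ψ d b`), and the specialised minors are the
  `d × d`… `N × N` minors of the `k`-matrix of the linear map `u ↦ ([y^k] Σ u_{ij} β̃ⁱ (δ₀²y)ʲ)_k`
  (`det_Mk_eq`);
* the CRITERION (Kaltofen §2 / [Kaltofen 1985a, Thm. 1], in our normalisation):
  `ψ = g h` with monic non-constant `g, h` ⟹ all specialised minors vanish at `ζ₀`
  (`minors_vanish_of_mul`), and `ψ` irreducible ⟹ some specialised minor is non-zero at `ζ₀`
  (`exists_minor_ne_zero_of_irreducible`; via Gauss's lemma over `k(y)`, Bézout for the Sylvester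
  resultant `Res_x(ψ, g)` (`Polynomial.resultant`) and `deg_y Res ≤ ℓ`).

## References

* E. Kaltofen, J. Comput. System Sci. 50 (1995) 274–295, §2 (Step L, systems (2)–(6)), §5.
  [`Kaltofen1995`]
* E. Kaltofen, *Polynomial-time reductions from multivariate to bi- and univariate integral
  polynomial factorization*, SIAM J. Comput. 14 (1985) 469–489, Thm. 1 (the resultant argument).
-/

noncomputable section

open Polynomial
open scoped Matrix

namespace Literature.RingTheory.MvPolynomial.NoetherForms

variable {R : Type*} [CommRing R] (d : ℕ) (a : Idx d → R)

/-! ### The generic linear system and its minors -/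

/-- The truncation order `ℓ = (2d - 1) d` (Kaltofen's `ℓ_max = (2d-1) deg_y f`), written
`(d + (d - 1)) · d` = the size of the Sylvester matrix of `Res_x(ψ, g)` times the `y`-degree bound.
[cite: Kaltofen1995, §2 (Absolute Irreducibility Test, `ℓ_max`)] -/
def ℓ (d : ℕ) : ℕ := (d + (d - 1)) * d

/-- The column polynomial of the unknown `u_{ij}`: `reduce((z + δ̂ Ā_ℓ)ⁱ (δ̂² y)ʲ) ∈ R[z][y]`.
[cite: Kaltofen1995, §2 (system (5))] -/
def colPoly (c : Idx d) : Polynomial R[X] :=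
  reduceY d a ((C X + δB d a * Abar d a (ℓ d)) ^ (c.1 : ℕ) * (δB d a ^ 2 * X) ^ (c.2 : ℕ))

/-- The generic matrix: `Mgen k c = [y^k] colPoly c ∈ R[z]` (`k ≤ ℓ`). [cite: Kaltofen1995, §2 (system (5))] -/
def Mgen (k : Fin (ℓ d + 1)) (c : Idx d) : R[X] := (colPoly d a c).coeff k

/-- The maximal minor on the rows `S c'`, `c' ∈ Idx d` (zero unless `S` is injective).
[cite: Kaltofen1995, Thm. 4 (the minors `Δ`)] -/
def minor (S : Idx d → Fin (ℓ d + 1)) : R[X] :=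
  (Matrix.of fun c' c : Idx d => Mgen d a (S c') c).det

/-- Index of a form of Stage I: a choice of rows and a power `ζ^ι`, `ι < d`. [folklore] -/
abbrev TIdx (d : ℕ) := (Idx d → Fin (ℓ d + 1)) × Fin d

/-- `tauR (S, ι)`: the `z^ι`-coefficient of the minor `minor S` reduced modulo `genF0`; for
`R = E₂ d`, `a = X` these are integer polynomials in the generic coefficients. [cite: Kaltofen1995, §5 (the set `S₃`)] -/
def tauR (t : TIdx d) : R := (reduce d a (minor d a t.1)).coeff t.2

variable {T : Type*} [CommRing T] (ψ' : R →+* T)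

/-- `colPoly` commutes with ring maps. [folklore] -/
theorem map_colPoly (c : Idx d) :
    (colPoly d a c).map (mapRingHom ψ') = colPoly d (ψ' ∘ a) c := by
  rw [colPoly, map_reduceY, Polynomial.map_mul, Polynomial.map_pow, Polynomial.map_pow,
    Polynomial.map_add, Polynomial.map_mul, Polynomial.map_mul, Polynomial.map_pow, map_δB,
    map_Abar, Polynomial.map_C, coe_mapRingHom, map_X, map_X, colPoly]

/-- `Mgen` commutes with ring maps. [folklore] -/
theorem map_Mgen (k : Fin (ℓ d + 1)) (c : Idx d) :
    (Mgen d a k c).map ψ' = Mgen d (ψ' ∘ a) k c := by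
  rw [Mgen, Mgen, ← map_colPoly, coeff_map, coe_mapRingHom]

/-- `minor` commutes with ring maps. [folklore] -/
theorem map_minor (S : Idx d → Fin (ℓ d + 1)) :
    (minor d a S).map ψ' = minor d (ψ' ∘ a) S := by
  rw [minor, minor, ← coe_mapRingHom, RingHom.map_det]
  congr 1
  ext c' c
  simp only [RingHom.mapMatrix_apply, Matrix.map_apply, Matrix.of_apply, coe_mapRingHom, map_Mgen]

/-- `tauR` commutes with ring maps. [folklore] -/
theorem map_tauR (t : TIdx d) : ψ' (tauR d a t) = tauR d (ψ' ∘ a) t := by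
  rw [tauR, tauR, ← map_minor, ← map_reduce, coeff_map]

/-! ### The monic bivariate polynomial `ψ` and its `x ↔ y` swap -/

/-- `psi d a = x^d + Σ a_{ij} xⁱ yʲ ∈ R[y][x]` (outer variable `x`, inner variable `y`): the monic
bivariate polynomial with coefficient vector `a`. [cite: Kaltofen1995, §3 (generic `f`)] -/
def psi : Polynomial R[X] := Fat d (cB ∘ a) X (C X)

/-- `psi` as an explicit sum of monomials in `x`. [folklore] -/
theorem psi_eq : psi d a = X ^ d + ∑ ij : Idx d, C (C (a ij) * X ^ (ij.2 : ℕ)) * X ^ (ij.1 : ℕ) := by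
  unfold psi Fat
  refine congrArg _ (Finset.sum_congr rfl fun ij _ => ?_)
  rw [map_mul, map_pow, Function.comp_apply, RingHom.comp_apply, mul_right_comm]

/-- The `x`-coefficients of `psi` below `d`. [folklore] -/
theorem coeff_psi_of_lt {n : ℕ} (hn : n < d) :
    (psi d a).coeff n = ∑ j : Fin (d + 1), C (a (⟨n, hn⟩, j)) * X ^ (j : ℕ) := by
  rw [psi_eq, coeff_add, coeff_X_pow, if_neg hn.ne, zero_add, finsetSum_coeff,
    Fintype.sum_prod_type]
  simp only [coeff_C_mul, coeff_X_pow, mul_ite, mul_one, mul_zero]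
  rw [Finset.sum_eq_single (⟨n, hn⟩ : Fin d)]
  · simp
  · intro i _ hi
    rw [Finset.sum_eq_zero]
    intro j _
    rw [if_neg]
    exact fun h => hi (Fin.ext h.symm)
  · exact fun h => (h (Finset.mem_univ _)).elim

/-- The `x^d`-coefficient of `psi` is `1`. [folklore] -/
theorem coeff_psi_d : (psi d a).coeff d = 1 := by
  rw [psi_eq, coeff_add, coeff_X_pow, if_pos rfl, finsetSum_coeff, Finset.sum_eq_zero, add_zero]
  intro ij _
  rw [coeff_C_mul, coeff_X_pow, if_neg (by have := ij.1.2; omega), mul_zero]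

/-- The `x`-coefficients of `psi` above `d` vanish. [folklore] -/
theorem coeff_psi_of_gt {n : ℕ} (hn : d < n) : (psi d a).coeff n = 0 := by
  rw [psi_eq, coeff_add, coeff_X_pow, if_neg (by omega), finsetSum_coeff, Finset.sum_eq_zero, add_zero]
  intro ij _
  rw [coeff_C_mul, coeff_X_pow, if_neg (by have := ij.1.2; omega), mul_zero]

/-- Every `x`-coefficient of `psi` has `y`-degree `≤ d`. [folklore] -/
theorem natDegree_coeff_psi_le (n : ℕ) : ((psi d a).coeff n).natDegree ≤ d := by
  rcases lt_trichotomy n d with hn | rfl | hn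
  · rw [coeff_psi_of_lt d a hn]
    refine natDegree_sum_le_of_forall_le _ _ fun j _ => (natDegree_C_mul_X_pow_le _ _).trans ?_
    have := j.2
    omega
  · rw [coeff_psi_d, natDegree_one]
    exact Nat.zero_le _
  · rw [coeff_psi_of_gt d a hn, natDegree_zero]
    exact Nat.zero_le _

/-- `deg_x psi ≤ d`. [folklore] -/
theorem natDegree_psi_le : (psi d a).natDegree ≤ d :=
  natDegree_le_iff_coeff_eq_zero.mpr fun _ hn => coeff_psi_of_gt d a hn

/-- `psi` is monic in `x`. [folklore] -/
theorem monic_psi : (psi d a).Monic := by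
  nontriviality R
  have hdeg : (psi d a).natDegree = d :=
    le_antisymm (natDegree_psi_le d a) (le_natDegree_of_ne_zero (by rw [coeff_psi_d]; exact one_ne_zero))
  rw [Monic, leadingCoeff, hdeg, coeff_psi_d]

/-- `deg_x psi = d` over a nontrivial ring. [folklore] -/
theorem natDegree_psi [Nontrivial R] : (psi d a).natDegree = d :=
  le_antisymm (natDegree_psi_le d a) (le_natDegree_of_ne_zero (by rw [coeff_psi_d]; exact one_ne_zero))

/-- `psi` commutes with ring maps. [folklore] -/
theorem map_psi : (psi d a).map (mapRingHom ψ') = psi d (ψ' ∘ a) := by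
  rw [psi, psi, ← coe_mapRingHom, map_Fat, mapRingHom_comp_cB, coe_mapRingHom, map_X,
    Polynomial.map_C, coe_mapRingHom, map_X]

/-- Setting `y = 0` in `psi` gives `genF0`. [folklore] -/
theorem map_evalRingHom_zero_psi : (psi d a).map (evalRingHom 0) = genF0 d a := by
  rw [psi, ← coe_mapRingHom, map_Fat, coe_mapRingHom, map_X, Polynomial.map_C, coe_evalRingHom,
    eval_X, Fat_eq, map_zero, zero_mul, add_zero]
  have hcomp : (map (evalRingHom 0) : Polynomial R[X] → R[X]) ∘ (cB ∘ a) = (C : R →+* R[X]) ∘ a := by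
    ext ij
    simp only [Function.comp_apply, RingHom.coe_comp, Polynomial.map_C, coe_evalRingHom, eval_C]
  rw [hcomp, ← map_genF0, eval_map, eval₂_C_X]

/-- The swap `x ↔ y` of `R[y][x]`. [folklore] -/
def swapXY : Polynomial R[X] →+* Polynomial R[X] :=
  eval₂RingHom (eval₂RingHom ((C : R[X] →+* Polynomial R[X]).comp (C : R →+* R[X])) X) (C X)

/-- The swap on inner constants. [folklore] -/
@[simp] theorem swapXY_C_C (r : R) : swapXY (C (C r) : Polynomial R[X]) = C (C r) := by
  simp [swapXY]

/-- The swap sends `x` to `y`. [folklore] -/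
@[simp] theorem swapXY_X : swapXY (X : Polynomial R[X]) = C X := by
  simp [swapXY]

/-- The swap sends `y` to `x`. [folklore] -/
@[simp] theorem swapXY_C_X : swapXY (C X : Polynomial R[X]) = X := by
  simp [swapXY]

/-- The swap on a constant `C p` is `p` with `y` renamed `x`. [folklore] -/
theorem swapXY_C (p : R[X]) : swapXY (C p : Polynomial R[X]) = p.map C := by
  rw [swapXY, coe_eval₂RingHom, eval₂_C, coe_eval₂RingHom, ← eval₂_map, ← coe_mapRingHom, eval₂_C_X]

/-- The swap is an involution. [folklore] -/
theorem swapXY_swapXY (P : Polynomial R[X]) : swapXY (swapXY P) = P := by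
  have h1 : ((swapXY.comp swapXY).comp C : R[X] →+* Polynomial R[X]) = (RingHom.id _).comp C :=
    Polynomial.ringHom_ext (fun r => by simp) (by simp)
  have : ((swapXY : Polynomial R[X] →+* _).comp swapXY) = RingHom.id _ :=
    Polynomial.ringHom_ext (fun p => RingHom.congr_fun h1 p) (by simp)
  exact RingHom.congr_fun this P

/-- Swapping the coefficient side: `swapXY (C p) = p.map C` has `x`-coefficients `C (p.coeff m)`, so a
`y`-coefficient survives the swap: if `(g.coeff i).coeff m ≠ 0` then `(swapXY g).coeff m ≠ 0`.
[folklore] -/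
theorem coeff_swapXY (g : Polynomial R[X]) (m : ℕ) :
    (swapXY g).coeff m = ∑ i ∈ g.support, C ((g.coeff i).coeff m) * X ^ i := by
  conv_lhs => rw [g.as_sum_support_C_mul_X_pow, map_sum]
  rw [finsetSum_coeff]
  refine Finset.sum_congr rfl fun i _ => ?_
  rw [map_mul, map_pow, swapXY_X, swapXY_C, ← map_pow, coeff_mul_C, coeff_map]

/-- The `X^i`-coefficient of `(swapXY g).coeff m` is `(g.coeff i).coeff m`. [folklore] -/
theorem coeff_coeff_swapXY (g : Polynomial R[X]) (m i : ℕ) :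
    ((swapXY g).coeff m).coeff i = (g.coeff i).coeff m := by
  rw [coeff_swapXY, finsetSum_coeff]
  simp only [coeff_C_mul, coeff_X_pow, mul_ite, mul_one, mul_zero]
  rw [Finset.sum_ite_eq g.support i]
  split_ifs with h
  · rfl
  · rw [Polynomial.notMem_support_iff.mp h, coeff_zero]

/-- The swapped `psi` has `x`-degree `≤ d` (its `x`-degree is the `y`-degree of `psi`). [folklore] -/
theorem natDegree_swapXY_psi_le : (swapXY (psi d a)).natDegree ≤ d := by
  rw [psi_eq, map_add, map_pow, swapXY_X, map_sum, ← map_pow]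
  refine (natDegree_add_le _ _).trans (max_le (by rw [natDegree_C]; exact Nat.zero_le _) ?_)
  refine natDegree_sum_le_of_forall_le _ _ fun ij _ => ?_
  rw [map_mul, map_pow, swapXY_X, swapXY_C, ← map_pow, Polynomial.map_mul, Polynomial.map_pow,
    map_X, Polynomial.map_C, mul_right_comm, ← map_mul]
  exact (natDegree_C_mul_X_pow_le _ _).trans (Nat.lt_succ_iff.mp ij.2.2)

/-- `y`-degrees of a divisor of `psi` are at most `d` (over a domain). [folklore] -/
theorem natDegree_coeff_le_of_dvd_psi [IsDomain R] {g : Polynomial R[X]} (hg : g ∣ psi d a) (i : ℕ) :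
    (g.coeff i).natDegree ≤ d := by
  nontriviality R
  have hne : swapXY (psi d a) ≠ 0 := fun h => by
    have := congrArg swapXY h
    rw [swapXY_swapXY, map_zero] at this
    exact (monic_psi d a).ne_zero this
  have hle : (swapXY g).natDegree ≤ d :=
    (natDegree_le_of_dvd (map_dvd swapXY hg) hne).trans (natDegree_swapXY_psi_le d a)
  refine natDegree_le_iff_coeff_eq_zero.mpr fun m hm => ?_
  by_contra hne'
  have h1 : ((swapXY g).coeff m).coeff i ≠ 0 := by rwa [coeff_coeff_swapXY]
  have h2 : (swapXY g).coeff m ≠ 0 := fun h => h1 (by rw [h, coeff_zero])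
  exact (Nat.lt_of_le_of_lt hle hm).not_ge (le_natDegree_of_ne_zero h2)

/-! ### Specialisation at a simple root of `genF0` -/

section Specialize

variable {k : Type*} [CommRing k] (b : Idx d → k) (ζ₀ : k)

/-- `δ₀ = genF0'(ζ₀)`, i.e. `(∂ψ/∂x)(ζ₀, 0)`. [cite: Kaltofen1995, §2 (Step N)] -/
def δ0 : k := (deltaHat d b).eval ζ₀

/-- `β̄ = Ā_ℓ` with `z ↦ ζ₀`. [folklore] -/
def βbar : k[X] := (Abar d b (ℓ d)).map (evalRingHom ζ₀)

/-- The truncated SCALED root `β̃ = ζ₀ + δ₀ β̄(y)` (`= α(δ₀² y) mod y^{ℓ+1}` for the power-series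
root `α` of `ψ` with `α(0) = ζ₀`). [cite: Kaltofen1995, §2 (Step N, the approximate root `α`)] -/
def βtil : k[X] := C ζ₀ + C (δ0 d b ζ₀) * βbar d b ζ₀

/-- The rescaling `y ↦ δ₀² y` of `k[y]`. [folklore] -/
def θδ : k[X] →+* k[X] := eval₂RingHom C (C (δ0 d b ζ₀ ^ 2) * X)

/-- `P(x, y) ↦ P(β̃(y), δ₀² y)`: evaluation of `k[y][x]` on the scaled truncated root. [folklore] -/
def evθ : Polynomial k[X] →+* k[X] := eval₂RingHom (θδ d b ζ₀) (βtil d b ζ₀)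

variable {b ζ₀}

/-- At a root of `genF0`, `zpow k ↦ ζ₀^k`. [folklore] -/
theorem eval_zpow (hroot : (genF0 d b).eval ζ₀ = 0) (n : ℕ) : (zpow d b n).eval ζ₀ = ζ₀ ^ n := by
  have h := Polynomial.eval_dvd (x := ζ₀) (genF0_dvd_zpow_sub d b n)
  rw [hroot, zero_dvd_iff, eval_sub, eval_pow, eval_X, sub_eq_zero] at h
  exact h

/-- At a root of `genF0`, `reduce` is invisible. [folklore] -/
theorem eval_reduce (hroot : (genF0 d b).eval ζ₀ = 0) (P : k[X]) : (reduce d b P).eval ζ₀ = P.eval ζ₀ := by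
  have h := Polynomial.eval_dvd (x := ζ₀) (genF0_dvd_reduce_sub d b P)
  rw [hroot, zero_dvd_iff, eval_sub, sub_eq_zero] at h
  exact h

/-- At a root of `genF0`, `reduceY` is invisible. [folklore] -/
theorem map_reduceY_eval (hroot : (genF0 d b).eval ζ₀ = 0) (P : Polynomial k[X]) :
    (reduceY d b P).map (evalRingHom ζ₀) = P.map (evalRingHom ζ₀) := by
  ext m : 1
  rw [coeff_map, coeff_map, coeff_reduceY, coe_evalRingHom, eval_reduce d hroot]

/-- `β̄` has no constant term. [folklore] -/
theorem coeff_zero_βbar : (βbar d b ζ₀).coeff 0 = 0 := by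
  rw [βbar, coeff_map, X_dvd_iff.mp (Abar_spec d b (ℓ d)).1, map_zero]

/-- `β̃(0) = ζ₀`. [folklore] -/
theorem eval_zero_βtil : (βtil d b ζ₀).eval 0 = ζ₀ := by
  rw [βtil, eval_add, eval_C, eval_mul, eval_C, ← coeff_zero_eq_eval_zero, coeff_zero_βbar,
    mul_zero, add_zero]

/-- THE TRUNCATED ROOT PROPERTY: `y^{ℓ+1} ∣ ψ(β̃(y), δ₀² y)`, in the form
`y^{ℓ+1} ∣ Fat b (β̃) (δ₀² y)`. [cite: Kaltofen1995, §2 (Step N: `f(α, y) ≡ 0 mod y^{ℓ_max + 1}`)] -/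
theorem X_pow_dvd_Fat_βtil (hroot : (genF0 d b).eval ζ₀ = 0) :
    (X : k[X]) ^ (ℓ d + 1) ∣
      Fat d ((C : k →+* k[X]) ∘ b) (βtil d b ζ₀) (C (δ0 d b ζ₀ ^ 2) * X) := by
  set Θ : Polynomial k[X] →+* k[X] := mapRingHom (evalRingHom ζ₀) with hΘ
  set A := Abar d b (ℓ d) with hA
  have hc : (Θ : Polynomial k[X] → k[X]) ∘ (cB ∘ b) = (C : k →+* k[X]) ∘ b := by
    ext ij
    simp only [hΘ, Function.comp_apply, coe_mapRingHom, RingHom.coe_comp, Polynomial.map_C,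
      coe_evalRingHom, eval_C]
  have hzx : Θ (C X) = C ζ₀ := by
    rw [hΘ, coe_mapRingHom, Polynomial.map_C, coe_evalRingHom, eval_X]
  have hX : Θ X = X := by rw [hΘ, coe_mapRingHom, map_X]
  have hδ : Θ (δB d b) = C (δ0 d b ζ₀) := by
    rw [hΘ, coe_mapRingHom, δB, Polynomial.map_C, coe_evalRingHom, δ0]
  have h0 : Θ (C (genF0 d b)) = 0 := by
    rw [hΘ, coe_mapRingHom, Polynomial.map_C, coe_evalRingHom, hroot, map_zero]
  have hAb : Θ A = βbar d b ζ₀ := by rw [hΘ, coe_mapRingHom, hA, βbar]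
  have h1 := congrArg Θ (Fat_scaled d b A)
  rw [map_Fat] at h1
  simp only [map_add, map_mul, map_pow, map_sub, hc, hzx, hX, hδ, h0, hAb, zero_add] at h1
  -- `h1 : Fat (C ∘ b) (C ζ₀ + C δ₀ * β̄) (C δ₀ ^ 2 * X) = C δ₀ ^ 2 * (β̄ - Θ (Nop A))`
  have h2 : (X : k[X]) ^ (ℓ d + 1) ∣ βbar d b ζ₀ - Θ (Nop d b A) := by
    have h := map_dvd Θ (Abar_spec d b (ℓ d)).2
    rw [map_pow, hX, map_sub, ← hA, hAb] at h
    have h3 : Θ (reduceY d b (Nop d b A)) = Θ (Nop d b A) := by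
      rw [hΘ, coe_mapRingHom, map_reduceY_eval d hroot]
    rwa [h3] at h
  rw [βtil, map_pow, h1]
  exact dvd_mul_of_dvd_right h2 _

/-- `evθ` on inner constants. [folklore] -/
@[simp] theorem evθ_C_C (r : k) : evθ d b ζ₀ (C (C r)) = C r := by
  simp [evθ, θδ]

/-- `evθ x = β̃`. [folklore] -/
@[simp] theorem evθ_X : evθ d b ζ₀ X = βtil d b ζ₀ := by
  simp [evθ]

/-- `evθ y = δ₀² y`. [folklore] -/
@[simp] theorem evθ_C_X : evθ d b ζ₀ (C X) = C (δ0 d b ζ₀ ^ 2) * X := by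
  simp [evθ, θδ]

/-- `evθ (C p) = p(δ₀² y)`. [folklore] -/
theorem evθ_C (p : k[X]) : evθ d b ζ₀ (C p) = p.comp (C (δ0 d b ζ₀ ^ 2) * X) := by
  simp [evθ, θδ, comp]

/-- `evθ ψ = Fat b β̃ (δ₀² y)`, hence `y^{ℓ+1} ∣ evθ ψ`. [cite: Kaltofen1995, §2 (Step N)] -/
theorem X_pow_dvd_evθ_psi (hroot : (genF0 d b).eval ζ₀ = 0) :
    (X : k[X]) ^ (ℓ d + 1) ∣ evθ d b ζ₀ (psi d b) := by
  have : evθ d b ζ₀ (psi d b) = Fat d ((C : k →+* k[X]) ∘ b) (βtil d b ζ₀) (C (δ0 d b ζ₀ ^ 2) * X) := by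
    rw [psi, map_Fat, evθ_X, evθ_C_X]
    congr 1
    ext ij
    simp
  rw [this]
  exact X_pow_dvd_Fat_βtil d hroot

/-! ### The specialised linear system -/

/-- The `k`-matrix of `u ↦ ([y^k] Σ u_{ij} β̃ⁱ (δ₀² y)ʲ)_{k ≤ ℓ}`. [cite: Kaltofen1995, §2 (system (5))] -/
def Mk (b : Idx d → k) (ζ₀ : k) : Matrix (Fin (ℓ d + 1)) (Idx d) k :=
  Matrix.of fun k' c => (βtil d b ζ₀ ^ (c.1 : ℕ) * (C (δ0 d b ζ₀ ^ 2) * X) ^ (c.2 : ℕ)).coeff k'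

/-- The specialised matrix is the generic one at `z = ζ₀`. [folklore] -/
theorem Mk_apply_eq (hroot : (genF0 d b).eval ζ₀ = 0) (k' : Fin (ℓ d + 1)) (c : Idx d) :
    Mk d b ζ₀ k' c = (Mgen d b k' c).eval ζ₀ := by
  rw [Mk, Matrix.of_apply, Mgen, colPoly, coeff_reduceY, eval_reduce d hroot, ← coe_evalRingHom,
    ← coeff_map, Polynomial.map_mul, Polynomial.map_pow, Polynomial.map_pow, Polynomial.map_add,
    Polynomial.map_mul, Polynomial.map_mul, Polynomial.map_pow, Polynomial.map_C, coe_evalRingHom,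
    eval_X, map_X, δB, Polynomial.map_C, coe_evalRingHom]
  simp only [βtil, δ0, βbar, map_pow]

/-- The unknown polynomial `g_u = Σ u_{ij} xⁱ yʲ ∈ k[y][x]`. [cite: Kaltofen1995, §2 (Step L, the Ansatz)] -/
def gPoly (u : Idx d → k) : Polynomial k[X] :=
  ∑ c : Idx d, C (C (u c) * X ^ (c.2 : ℕ)) * X ^ (c.1 : ℕ)

/-- `[y^k] g_u(β̃, δ₀²y) = (Mk u)_k`. [folklore] -/
theorem coeff_evθ_gPoly (u : Idx d → k) (k' : Fin (ℓ d + 1)) :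
    (evθ d b ζ₀ (gPoly d u)).coeff k' = (Mk d b ζ₀ *ᵥ u) k' := by
  rw [gPoly, map_sum, finsetSum_coeff, Matrix.mulVec, dotProduct]
  refine Finset.sum_congr rfl fun c _ => ?_
  simp only [map_mul, map_pow, evθ_X, evθ_C_C, evθ_C_X]
  rw [Mk, Matrix.of_apply, mul_assoc, coeff_C_mul, map_pow, mul_comm ((C (δ0 d b ζ₀) ^ 2 * X) ^ (c.2 : ℕ)),
    mul_comm]

/-- `y^{ℓ+1} ∣ g_u(β̃, δ₀²y)` iff `u` is in the kernel of `Mk`. [folklore] -/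
theorem X_pow_dvd_evθ_gPoly_iff (u : Idx d → k) :
    (X : k[X]) ^ (ℓ d + 1) ∣ evθ d b ζ₀ (gPoly d u) ↔ Mk d b ζ₀ *ᵥ u = 0 := by
  rw [X_pow_dvd_iff]
  constructor
  · intro h
    ext k'
    rw [← coeff_evθ_gPoly, Pi.zero_apply]
    exact h k' k'.2
  · intro h n hn
    have := congr_fun h ⟨n, hn⟩
    rwa [← coeff_evθ_gPoly, Pi.zero_apply] at this

/-- The `x`-coefficients of `g_u`. [folklore] -/
theorem coeff_gPoly (u : Idx d → k) (i : Fin d) :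
    (gPoly d u).coeff i = ∑ j : Fin (d + 1), C (u (i, j)) * X ^ (j : ℕ) := by
  rw [gPoly, finsetSum_coeff, Fintype.sum_prod_type]
  simp only [coeff_C_mul, coeff_X_pow, mul_ite, mul_one, mul_zero]
  rw [Finset.sum_eq_single i]
  · simp
  · intro i' _ hi
    rw [Finset.sum_eq_zero]
    intro j _
    rw [if_neg]
    exact fun h => hi (Fin.ext h.symm)
  · exact fun h => (h (Finset.mem_univ _)).elim

/-- The `xⁱyʲ`-coefficient of `g_u` is `u (i, j)`. [folklore] -/
theorem coeff_coeff_gPoly (u : Idx d → k) (c : Idx d) : ((gPoly d u).coeff c.1).coeff c.2 = u c := by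
  rw [coeff_gPoly, finsetSum_coeff]
  simp only [coeff_C_mul, coeff_X_pow, mul_ite, mul_one, mul_zero]
  rw [Finset.sum_eq_single c.2]
  · simp
  · intro j _ hj
    rw [if_neg]
    exact fun h => hj (Fin.ext h.symm)
  · exact fun h => (h (Finset.mem_univ _)).elim

/-- `x`-coefficients of `g_u` at or above `d` vanish. [folklore] -/
theorem coeff_gPoly_of_le (u : Idx d → k) {n : ℕ} (hn : d ≤ n) : (gPoly d u).coeff n = 0 := by
  rw [gPoly, finsetSum_coeff, Finset.sum_eq_zero]
  intro c _
  rw [coeff_C_mul, coeff_X_pow, if_neg (by have := c.1.2; omega), mul_zero]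

/-- `deg_x g_u < d` (`d ≥ 1`). [folklore] -/
theorem natDegree_gPoly_lt (hd : 0 < d) (u : Idx d → k) : (gPoly d u).natDegree < d := by
  have : (gPoly d u).natDegree ≤ d - 1 :=
    natDegree_le_iff_coeff_eq_zero.mpr fun n hn => coeff_gPoly_of_le d u (by omega)
  omega

/-- Every `x`-coefficient of `g_u` has `y`-degree `≤ d`. [folklore] -/
theorem natDegree_coeff_gPoly_le (u : Idx d → k) (n : ℕ) : ((gPoly d u).coeff n).natDegree ≤ d := by
  by_cases hn : n < d
  · rw [show n = ((⟨n, hn⟩ : Fin d) : ℕ) from rfl, coeff_gPoly]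
    refine natDegree_sum_le_of_forall_le _ _ fun j _ => (natDegree_C_mul_X_pow_le _ _).trans ?_
    exact Nat.lt_succ_iff.mp j.2
  · rw [coeff_gPoly_of_le d u (not_lt.mp hn), natDegree_zero]
    exact Nat.zero_le _

/-- `g_u = 0` only for `u = 0`. [folklore] -/
theorem gPoly_ne_zero {u : Idx d → k} (hu : u ≠ 0) : gPoly d u ≠ 0 := by
  obtain ⟨c, hc⟩ := Function.ne_iff.mp hu
  intro h
  apply hc
  rw [← coeff_coeff_gPoly d u c, h, coeff_zero, coeff_zero, Pi.zero_apply]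

/-- THE MINORS: the specialised `N × N` minor on rows `S` equals `Σ_ι tauR (S, ι) ζ₀^ι`, the value at
`ζ₀` of the reduced generic minor. [cite: Kaltofen1995, §5 (proof of Thm. 7: `Δ'` at the coefficients)] -/
theorem det_Mk_submatrix (hd : 0 < d) (hroot : (genF0 d b).eval ζ₀ = 0)
    (S : Idx d → Fin (ℓ d + 1)) :
    (Matrix.of fun c' c : Idx d => Mk d b ζ₀ (S c') c).det =
      ∑ ι : Fin d, tauR d b (S, ι) * ζ₀ ^ (ι : ℕ) := by
  have h1 : (Matrix.of fun c' c : Idx d => Mk d b ζ₀ (S c') c) =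
      (evalRingHom ζ₀).mapMatrix (Matrix.of fun c' c : Idx d => Mgen d b (S c') c) := by
    ext c' c
    simp only [Matrix.of_apply, RingHom.mapMatrix_apply, Matrix.map_apply, coe_evalRingHom,
      Mk_apply_eq d hroot]
  rw [h1, ← RingHom.map_det, coe_evalRingHom, ← minor, ← eval_reduce d hroot,
    eval_eq_sum_range' (natDegree_reduce_lt d b hd _), ← Fin.sum_univ_eq_sum_range (fun ι =>
      (reduce d b (minor d b S)).coeff ι * ζ₀ ^ ι) d]
  rfl

end Specialize

/-! ### Linear algebra: all maximal minors vanish iff the columns are dependent -/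

section LinAlg

variable {K : Type*} [Field K] {m n : Type*} [Fintype m] [Fintype n] [DecidableEq n]

/-- If every `n × n` row-selection `S` of a matrix `M ∈ K^{m × n}` has vanishing determinant then
`M` has a non-trivial kernel (row rank = column rank). [folklore] -/
theorem exists_mulVec_eq_zero_of_det_submatrix_eq_zero (M : Matrix m n K)
    (h : ∀ S : n → m, (M.submatrix S id).det = 0) : ∃ u : n → K, u ≠ 0 ∧ M *ᵥ u = 0 := by
  by_contra hcon
  push Not at hcon
  -- the columns are independent: `mulVec` is injective
  have hinj : Function.Injective M.mulVecLin := by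
    rw [← LinearMap.ker_eq_bot, LinearMap.ker_eq_bot']
    intro u hu
    by_contra hu0
    exact hcon u hu0 hu
  have hrank : M.rank = Fintype.card n := by
    rw [Matrix.rank, LinearMap.finrank_range_of_inj hinj, Module.finrank_fintype_fun_eq_card]
  -- extract `card n` independent rows
  obtain ⟨κ, f, hf, hspan, hli⟩ := exists_linearIndependent' K (M.row : m → n → K)
  haveI : Finite κ := Finite.of_injective f hf
  letI : Fintype κ := Fintype.ofFinite κ
  have hcard : Fintype.card κ = Fintype.card n := by
    rw [← hrank, Matrix.rank_eq_finrank_span_row, ← hspan, finrank_span_eq_card hli]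
  obtain ⟨e⟩ : Nonempty (n ≃ κ) := Fintype.card_eq.mp hcard.symm
  have hli' : LinearIndependent K ((M.submatrix (f ∘ e) id).row) := by
    have : (M.submatrix (f ∘ e) id).row = (M.row ∘ f) ∘ e := by
      ext c c'
      rfl
    rw [this]
    exact hli.comp e e.injective
  have hunit := (Matrix.linearIndependent_rows_iff_isUnit.mp hli')
  rw [Matrix.isUnit_iff_isUnit_det, h (f ∘ e)] at hunit
  exact not_isUnit_zero hunit

end LinAlg

/-! ### The irreducibility criterion at a simple root -/

section Criterion

variable {k : Type*} [Field k] {b : Idx d → k} {ζ₀ : k}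

/-- Evaluation at `(x, y) = (ζ₀, 0)`. [folklore] -/
def ev00 (ζ₀ : k) : Polynomial k[X] →+* k := eval₂RingHom (evalRingHom 0) ζ₀

/-- `ev00 P = P(ζ₀, 0)` computed by first setting `y = 0`. [folklore] -/
theorem ev00_apply (P : Polynomial k[X]) : ev00 ζ₀ P = (P.map (evalRingHom 0)).eval ζ₀ := by
  rw [ev00, coe_eval₂RingHom, eval_map]

/-- The constant term of `evθ P` is `P(ζ₀, 0)`. [folklore] -/
theorem eval_zero_evθ (P : Polynomial k[X]) : (evθ d b ζ₀ P).eval 0 = ev00 ζ₀ P := by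
  have : ((evalRingHom 0).comp (evθ d b ζ₀)) = ev00 ζ₀ := by
    refine Polynomial.ringHom_ext (fun p => ?_) ?_
    · rw [RingHom.comp_apply, evθ_C, coe_evalRingHom, eval_comp, eval_mul, eval_C, eval_X, mul_zero,
        ev00, coe_eval₂RingHom, eval₂_C, coe_evalRingHom]
    · rw [RingHom.comp_apply, evθ_X, coe_evalRingHom, eval_zero_βtil, ev00, coe_eval₂RingHom, eval₂_X]
  rw [← this]
  rfl

/-- (S⇐), core: if `ψ = g h` with `g` monic, `deg_x g < d`, and `g(ζ₀, 0) = 0` at a SIMPLE root `ζ₀`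
of `ψ(x, 0)`, then the coefficient vector of `g` is a non-zero kernel vector, so every specialised
maximal minor vanishes. [cite: Kaltofen1995, §2 (correctness of Absolute Irreducibility Test)] -/
theorem minors_vanish_of_mul_of_ev00 (hd : 0 < d) (hroot : (genF0 d b).eval ζ₀ = 0)
    (hδ : δ0 d b ζ₀ ≠ 0) {g h : Polynomial k[X]} (hg : g.Monic) (hgd : g.natDegree < d)
    (hψ : psi d b = g * h) (hg0 : ev00 ζ₀ g = 0) (S : Idx d → Fin (ℓ d + 1)) :
    ∑ ι : Fin d, tauR d b (S, ι) * ζ₀ ^ (ι : ℕ) = 0 := by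
  -- `h(ζ₀, 0) ≠ 0` since `ζ₀` is a simple root of `ψ(x,0) = g(x,0) h(x,0)`
  have hh0 : ev00 ζ₀ h ≠ 0 := by
    intro hh0
    apply hδ
    have e := congrArg (Polynomial.map (evalRingHom 0)) hψ
    rw [map_evalRingHom_zero_psi, Polynomial.map_mul] at e
    rw [ev00_apply] at hg0 hh0
    rw [δ0, deltaHat, e, derivative_mul, eval_add, eval_mul, eval_mul, hg0, hh0, mul_zero, zero_mul,
      add_zero]
  -- `y^{ℓ+1} ∣ g(β̃, δ₀² y)`
  have hcop : IsCoprime ((X : k[X]) ^ (ℓ d + 1)) (evθ d b ζ₀ h) := by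
    refine IsCoprime.pow_left ((Polynomial.irreducible_X.coprime_iff_not_dvd).mpr fun hX => hh0 ?_)
    rw [← eval_zero_evθ, ← coeff_zero_eq_eval_zero]
    exact X_dvd_iff.mp hX
  have hdvd : (X : k[X]) ^ (ℓ d + 1) ∣ evθ d b ζ₀ g := by
    refine hcop.dvd_of_dvd_mul_right ?_
    rw [← map_mul, ← hψ]
    exact X_pow_dvd_evθ_psi d hroot
  -- the coefficient vector of `g`
  set u : Idx d → k := fun c => (g.coeff c.1).coeff c.2 with hu
  have hgu : gPoly d u = g := by
    have hy : ∀ i, (g.coeff i).natDegree ≤ d := fun i =>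
      natDegree_coeff_le_of_dvd_psi d b (Dvd.intro h hψ.symm) i
    have e1 : g = ∑ i : Fin d, C (g.coeff i) * X ^ (i : ℕ) := by
      conv_lhs => rw [as_sum_range' g d hgd, ← Fin.sum_univ_eq_sum_range]
      simp only [C_mul_X_pow_eq_monomial]
    have e2 : ∀ i : Fin d, g.coeff i = ∑ j : Fin (d + 1), C (u (i, j)) * X ^ (j : ℕ) := by
      intro i
      conv_lhs => rw [as_sum_range' (g.coeff i) (d + 1) (Nat.lt_succ_of_le (hy i)),
        ← Fin.sum_univ_eq_sum_range]
      simp only [C_mul_X_pow_eq_monomial, hu]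
    rw [gPoly, Fintype.sum_prod_type]
    conv_rhs => rw [e1]
    refine Finset.sum_congr rfl fun i _ => ?_
    rw [e2, map_sum, Finset.sum_mul]
  have hu0 : u ≠ 0 := by
    intro h0
    have h1 : u (⟨g.natDegree, hgd⟩, 0) = 1 := by
      simp only [hu, Fin.val_zero]
      rw [hg.coeff_natDegree, coeff_one_zero]
    rw [h0, Pi.zero_apply] at h1
    exact zero_ne_one h1
  have hker : Mk d b ζ₀ *ᵥ u = 0 := by
    rw [← X_pow_dvd_evθ_gPoly_iff, hgu]
    exact hdvd
  rw [← det_Mk_submatrix d hd hroot S]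
  refine (Matrix.exists_mulVec_eq_zero_iff).mp ⟨u, hu0, ?_⟩
  ext c'
  have := congr_fun hker (S c')
  rw [Pi.zero_apply] at this ⊢
  rw [← this]
  rfl

/-- **(S⇐)** If `ψ = g h` splits into two monic factors of positive `x`-degree, then at every
simple root `ζ₀` of `ψ(x, 0)` all specialised maximal minors vanish:
`Σ_ι tauR (S, ι) ζ₀^ι = 0` for all `S`. [cite: Kaltofen1995, §2 (correctness of Absolute Irreducibility Test)] -/
theorem minors_vanish_of_mul (hd : 0 < d) (hroot : (genF0 d b).eval ζ₀ = 0) (hδ : δ0 d b ζ₀ ≠ 0)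
    {g h : Polynomial k[X]} (hg : g.Monic) (hh : h.Monic) (hgpos : 0 < g.natDegree)
    (hhpos : 0 < h.natDegree) (hψ : psi d b = g * h) (S : Idx d → Fin (ℓ d + 1)) :
    ∑ ι : Fin d, tauR d b (S, ι) * ζ₀ ^ (ι : ℕ) = 0 := by
  have hdeg : g.natDegree + h.natDegree = d := by
    rw [← hg.natDegree_mul hh, ← hψ, natDegree_psi]
  have h0 : ev00 ζ₀ g * ev00 ζ₀ h = 0 := by
    rw [← map_mul, ← hψ, ev00_apply, map_evalRingHom_zero_psi, hroot]
  rcases mul_eq_zero.mp h0 with hg0 | hh0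
  · exact minors_vanish_of_mul_of_ev00 d hd hroot hδ hg (by omega) hψ hg0 S
  · exact minors_vanish_of_mul_of_ev00 d hd hroot hδ hh (by omega) (by rw [hψ, mul_comm]) hh0 S

/-- Entries of a Sylvester matrix have degree bounded by the coefficients' degrees. [folklore] -/
theorem natDegree_sylvester_le {S : Type*} [CommRing S] (f g : S[X][X]) (m n B : ℕ)
    (hf : ∀ i, (f.coeff i).natDegree ≤ B) (hg : ∀ i, (g.coeff i).natDegree ≤ B)
    (i j : Fin (m + n)) : (Polynomial.sylvester f g m n i j).natDegree ≤ B := by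
  rw [Polynomial.sylvester, Matrix.of_apply]
  induction j using Fin.addCases with
  | left j₁ =>
    rw [Fin.addCases_left]
    split_ifs
    · exact hg _
    · simp
  | right j₁ =>
    rw [Fin.addCases_right]
    split_ifs
    · exact hf _
    · simp

/-- Rescaling `y ↦ a y` (`a ≠ 0`) kills no non-zero polynomial. [folklore] -/
theorem comp_C_mul_X_eq_zero_iff {a : k} (ha : a ≠ 0) (p : k[X]) : p.comp (C a * X) = 0 ↔ p = 0 := by
  refine ⟨fun h => ?_, fun h => by rw [h, zero_comp]⟩
  have : (p.comp (C a * X)).comp (C a⁻¹ * X) = p := by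
    rw [comp_assoc, mul_comp, C_comp, X_comp, ← mul_assoc, ← C_mul, mul_inv_cancel₀ ha, C_1, one_mul,
      comp_X]
  rw [← this, h, zero_comp]

/-- **(S⇒)** If `ψ` is irreducible in `k[y][x]` then at every simple root `ζ₀ ∈ k` of `ψ(x, 0)` some
specialised maximal minor is non-zero: `∃ S, Σ_ι tauR (S, ι) ζ₀^ι ≠ 0`. (A non-zero kernel vector
`u` would give `g_u ≠ 0`, `deg_x g_u < d`, with `y^{ℓ+1} ∣ g_u(β̃, δ₀²y)`; but `Res_x(ψ, g_u) ≠ 0`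
by Gauss's lemma over `k(y)`, it has `y`-degree `≤ (2d-1)d = ℓ`, and Bézout `pψ + qg_u = Res`
evaluated on the truncated root forces `y^{ℓ+1} ∣ Res(δ₀²y)`, i.e. `Res = 0`.)
[cite: Kaltofen1995, §2 (correctness of Absolute Irreducibility Test; Kaltofen 1985a Thm. 1)] -/
theorem exists_minor_ne_zero_of_irreducible (hd : 2 ≤ d) (hroot : (genF0 d b).eval ζ₀ = 0)
    (hδ : δ0 d b ζ₀ ≠ 0) (hirr : Irreducible (psi d b)) :
    ∃ S : Idx d → Fin (ℓ d + 1), ∑ ι : Fin d, tauR d b (S, ι) * ζ₀ ^ (ι : ℕ) ≠ 0 := by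
  have hd0 : 0 < d := by omega
  by_contra hall
  push Not at hall
  -- a non-zero kernel vector
  have hdet : ∀ S : Idx d → Fin (ℓ d + 1), ((Mk d b ζ₀).submatrix S id).det = 0 := by
    intro S
    rw [← hall S, ← det_Mk_submatrix d hd0 hroot S]
    rfl
  obtain ⟨u, hu0, hker⟩ := exists_mulVec_eq_zero_of_det_submatrix_eq_zero _ hdet
  set g := gPoly d u with hg
  have hgne : g ≠ 0 := gPoly_ne_zero d hu0
  have hgdeg : g.natDegree < d := natDegree_gPoly_lt d hd0 u
  have hgdvd : (X : k[X]) ^ (ℓ d + 1) ∣ evθ d b ζ₀ g := (X_pow_dvd_evθ_gPoly_iff d u).mpr hker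
  -- the resultant `Res_x(ψ, g)` with formal degrees `d, d - 1`
  set r : k[X] := (psi d b).resultant g d (d - 1) with hr
  -- Bézout
  obtain ⟨p, q, -, -, hpq⟩ := exists_mul_add_mul_eq_C_resultant (m := d) (n := d - 1) (psi d b) g
    (natDegree_psi_le d b) (by omega) (Or.inl (by omega))
  -- `Res ≠ 0`: Gauss's lemma over `k(y)`
  have hrne : r ≠ 0 := by
    let K' := FractionRing k[X]
    have hinjK : Function.Injective (algebraMap k[X] K') := IsFractionRing.injective k[X] K'
    have hirr' : Irreducible ((psi d b).map (algebraMap k[X] K')) :=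
      ((monic_psi d b).irreducible_iff_irreducible_map_fraction_map).mp hirr
    have hg' : g.map (algebraMap k[X] K') ≠ 0 := fun h0 =>
      hgne ((Polynomial.map_injective _ hinjK) (by rw [h0, Polynomial.map_zero]))
    have hgdeg' : (g.map (algebraMap k[X] K')).natDegree < d := (natDegree_map_le).trans_lt hgdeg
    have hψdeg' : ((psi d b).map (algebraMap k[X] K')).natDegree = d := by
      rw [(monic_psi d b).natDegree_map, natDegree_psi]
    have hndvd : ¬ (psi d b).map (algebraMap k[X] K') ∣ g.map (algebraMap k[X] K') := fun hdvd =>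
      (Nat.lt_irrefl d) (by simpa [hψdeg'] using (natDegree_le_of_dvd hdvd hg').trans_lt hgdeg')
    have hcop : IsCoprime ((psi d b).map (algebraMap k[X] K')) (g.map (algebraMap k[X] K')) :=
      (hirr'.coprime_iff_not_dvd).mpr hndvd
    have hres' : ((psi d b).map (algebraMap k[X] K')).resultant (g.map (algebraMap k[X] K')) ≠ 0 := by
      rw [Ne, resultant_eq_zero_iff, not_and_or, not_not]
      exact Or.inr hcop
    -- pass from the default formal degrees to `(d, d - 1)`
    have hle : (g.map (algebraMap k[X] K')).natDegree ≤ d - 1 := by omega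
    obtain ⟨e, he⟩ := Nat.exists_eq_add_of_le hle
    have hcoef : ((psi d b).map (algebraMap k[X] K')).coeff d = 1 := by
      have := ((monic_psi d b).map (algebraMap k[X] K')).coeff_natDegree
      rwa [hψdeg'] at this
    have hres'' : ((psi d b).map (algebraMap k[X] K')).resultant (g.map (algebraMap k[X] K')) d (d - 1)
        ≠ 0 := by
      have hadd := resultant_add_right_deg ((psi d b).map (algebraMap k[X] K')) (g.map (algebraMap k[X] K'))
        d (g.map (algebraMap k[X] K')).natDegree e le_rfl
      rw [he, hadd, hcoef, one_pow, one_mul]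
      rw [hψdeg'] at hres'
      exact hres'
    intro hr0
    apply hres''
    rw [resultant_map_map, ← hr, hr0, map_zero]
  -- `deg_y Res ≤ ℓ`
  have hrdeg : r.natDegree ≤ ℓ d := by
    rw [hr, Polynomial.resultant, ℓ]
    have := natDegree_det_le_of_le (Polynomial.sylvester (psi d b) g d (d - 1)) d
      (natDegree_sylvester_le _ _ _ _ _ (natDegree_coeff_psi_le d b) (natDegree_coeff_gPoly_le d u))
    rwa [Fintype.card_fin] at this
  -- Bézout on the truncated root: `y^{ℓ+1} ∣ Res(δ₀² y)`
  have hdvd : (X : k[X]) ^ (ℓ d + 1) ∣ r.comp (C (δ0 d b ζ₀ ^ 2) * X) := by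
    have e := congrArg (evθ d b ζ₀) hpq
    rw [map_add, map_mul, map_mul, evθ_C, ← hr] at e
    rw [← e]
    exact dvd_add (dvd_mul_of_dvd_left (X_pow_dvd_evθ_psi d hroot) _) (dvd_mul_of_dvd_left hgdvd _)
  have hzero : r.comp (C (δ0 d b ζ₀ ^ 2) * X) = 0 := by
    refine Polynomial.eq_zero_of_dvd_of_natDegree_lt hdvd ?_
    refine (natDegree_comp_le.trans ?_).trans_lt ?_ (b := ℓ d)
    · calc r.natDegree * (C (δ0 d b ζ₀ ^ 2) * X).natDegree ≤ ℓ d * 1 :=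
            Nat.mul_le_mul hrdeg ((natDegree_C_mul_le _ _).trans natDegree_X_le)
        _ = ℓ d := mul_one _
    · rw [natDegree_pow, natDegree_X, mul_one]
      exact Nat.lt_succ_self _
  exact hrne ((comp_C_mul_X_eq_zero_iff (pow_ne_zero 2 hδ) r).mp hzero)

end Criterion

end Literature.RingTheory.MvPolynomial.NoetherForms
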